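import Summits.QuantumFields.YangMills.Theorems.LuscherReductionDressedRitzPolyakovLiftPScalingParams
import Mathlib.Analysis.SpecialFunctions.Trigonometric.Bounds
import Mathlib.Analysis.Complex.ExponentialBounds
import HarnessLib

/-!
# Route `LuscherReduction`, crux `DressedRitz` (stmt-QuantumFields-20205), line «polyakovlift» r7, stub S-PSCAL″ — NEGATIVE LEMMA (tightness ∕ honest size;
# crux disprover ym-cdisprove-20205-1 g9): the vacuum-radius WINDOW of the pscaling assembly and the thresholds FORCED by the side conditions of the
# accepted quasimode package `PScal.quasimode_package` (p575204)

The S-PSCAL″ assembly (`PScal.pscaling_core`, p571951) is fed by the quasimode package (Q) (`PScal.quasimode_package`, p575204), whose eight side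
conditions (S1)–(S8) at `(L, Λ)` the quantifier shell discharges by choosing `lam0` and `L0(lam)`; the shell pins the observable radius
`R = radiusR Λ = Λ^{−1/4}` and the vacuum trial radius `R_v = 2/Λ` (`…PScalingParams`, p572436).  This file records, kernel-checked, three facts
about that regime (negative-side bookkeeping for the crux item; `Cruxes/DressedRitz/Disproof.lean` §13):

§1 THE VACUUM-RADIUS WINDOW.  `√2·Λ^{−1/4} ≤ 2/Λ < π/(√2Λ) < 2π/Λ < (2L/Λ)·tan(π/L) ≤ (2L/Λ)·tan(π/L + Λ‖y‖/(2L)) + ‖y‖` for `0 < Λ ≤ 1`, `L ≥ 3`: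
   the lead's radius sits between the assembly's floor `√2R ≤ R_v` and its cap `√2R_vΛ < π`, and the cap stays a factor `2√2` BELOW the certified echo
   zone of `Negative/EchoZoneFailure` (`shadowObs_mul_ground_not_ae_of_radius`: failure of the main-term identity for every
   `R_v ≥ (2L/Λ)tan(π/L + Λ‖y‖/(2L)) + ‖y‖`) — uniformly in `L ≥ 3`, so the echo-zone refutation never reaches an admissible radius
   (★ `vacuumRadius_window`, ★ `echoZone_misses_admissible_radius`).  Both ends of the window are now certified: above `2π/Λ(1+o(1))` the identity is
   false (g8), below `π/(√2Λ)` the assembly runs.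
§2 (S8) FORCES AN EXPONENTIAL FINE SIZE.  The contamination condition (S8)
   `(C_F/c_Q)²·e^{2·(4/18)·R⁴}·((X·(Λ/L) + A·e^{−2/Λ})/c_gap) ≤ Λ⁴/256` (`X = C₁ + (E_{K+1}+C₁)² + K_c/4`) implies
   `256·(C_F/c_Q)²·X·e^{(4/9)/Λ} ≤ c_gap·Λ³·L` (★ `sideCondition_eight_forces_L`); with `(C_F/c_Q)²·X ≥ c_gap` this is `L ≥ 256·e^{(4/9)/Λ}/Λ³`
   (★ `sideCondition_eight_L_ge`): every `L0(lam)` of a shell through p575204 is at least `256·e^{(4/9)/lam}/lam³`.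
§3 (S6) FORCES A TINY SCALE.  The cluster-smallness condition (S6) `P·((X·(Λ/L) + A·e^{−R})/c_gap + 2A′·ε♭²) ≤ Λ²/4` implies
   `P·A·e^{−R} ≤ c_gap·Λ²/4` (★ `sideCondition_six_forces`), and at `Λ = 2·10⁻⁶` one has `Λ²/4 = 10⁻¹² < e^{−27} < e^{−R}` (`R = 500000^{1/4} < 27`;
   ★ `exp_neg_radiusR_gt_at_2e6`), so (S6) FAILS there for every `L` as soon as `P·A ≥ c_gap` (★★ `sideCondition_six_fails_at_2e6`): every witness
   `lam0` of a shell through p575204 then satisfies `lam0 < 10⁻⁶` (take `lam = 10⁻⁶`, `Λ = 2·lam`).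
HONEST SIZE OF S-PSCAL″ AS CERTIFIED BY THE LINE: `Λ ≲ 10⁻⁶` and `L ≳ 256·e^{(4/9)·10⁶}` (conditional on the two displayed constant comparisons, which
hold for `P = (2A′+1)^{K+2} ≥ 27` unless the decay constant `A` resp. `(C_F/c_Q)²X` is below `c_gap/27` resp. `c_gap`).  No stub is refuted: S-PSCAL″ is an
`∃ lam0 ∃ L0` statement and the assembly is consistent (pre-vet g9: no objection); these are boundary lemmas of the regime it certifies.

HONEST FRAMING: real-inequality bookkeeping about the side conditions of ONE helper of ONE stub of ONE conditional crux on the femto rung R2b1; nothing here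
bears on infinite volume, the continuum limit or the Clay gap.
References: M. Lüscher, NPB 219 (1983) 233 [cite: Luscher1983, §2–§3]; Reed–Simon IV, Thm. XIII.1 [cite: ReedSimonIV1978, Thm. XIII.1].
-/

set_option autoImplicit false

noncomputable section

open Real

namespace Summit.QuantumFields.YangMills.Theorems.FemtoTransferGap.PolyakovLift.Negative

open Summit.QuantumFields.YangMills.Theorems.FemtoTransferGap.PScal

/-! ## §1 The vacuum-radius window -/

/-- `√2 < 3/2`. [folklore] -/
private theorem sqrt_two_lt_three_halves : Real.sqrt 2 < 3 / 2 := by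
  rw [show (3 / 2 : ℝ) = Real.sqrt ((3 / 2) ^ 2) from (Real.sqrt_sq (by norm_num)).symm]
  exact Real.sqrt_lt_sqrt (by norm_num) (by norm_num)

/-- `1 < √2`. [folklore] -/
private theorem one_lt_sqrt_two : 1 < Real.sqrt 2 := by
  rw [show (1 : ℝ) = Real.sqrt 1 from Real.sqrt_one.symm]
  exact Real.sqrt_lt_sqrt (by norm_num) (by norm_num)

/-- The echo threshold at the origin exceeds `2π/Λ`: `2π/Λ < tan(π/L)/(Λ/(2L)) = (2L/Λ)·tan(π/L)` for `L ≥ 3` (`x < tan x` on `(0, π/2)`). [folklore] -/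
theorem twoPi_div_lt_echoThreshold {Λ : ℝ} (hΛ : 0 < Λ) {L : ℕ} (hL : 3 ≤ L) :
    2 * π / Λ < Real.tan (π / L) / (Λ / (2 * L)) := by
  have hL' : (3 : ℝ) ≤ L := by exact_mod_cast hL
  have hLpos : (0 : ℝ) < L := by linarith
  have h0 : 0 < π / L := div_pos Real.pi_pos hLpos
  have h1 : π / L < π / 2 := by
    have hc : π / L ≤ π / 3 := div_le_div_of_nonneg_left Real.pi_pos.le (by norm_num) hL'
    linarith [Real.pi_pos]
  have ht : π / L < Real.tan (π / L) := Real.lt_tan h0 h1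
  have e1 : Real.tan (π / L) / (Λ / (2 * L)) = (2 * L / Λ) * Real.tan (π / L) := by field_simp
  have e2 : 2 * π / Λ = (2 * L / Λ) * (π / L) := by field_simp
  rw [e1, e2]
  exact mul_lt_mul_of_pos_left ht (by positivity)

/-- The echo threshold at a lit point `y` (`‖y‖ = r`) dominates the one at the origin: `tan(π/L)/μ ≤ tan(π/L + μr)/μ + r` (`π/L + μr < π/2`). [folklore] -/
theorem echoThreshold_origin_le {L : ℕ} (hL : 3 ≤ L) {μ r : ℝ} (hμ : 0 < μ) (hr : 0 ≤ r) (hang : π / L + μ * r < π / 2) :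
    Real.tan (π / L) / μ ≤ Real.tan (π / L + μ * r) / μ + r := by
  have hL' : (3 : ℝ) ≤ L := by exact_mod_cast hL
  have hLpos : (0 : ℝ) < L := by linarith
  have h0 : 0 < π / L := div_pos Real.pi_pos hLpos
  have hμr : 0 ≤ μ * r := mul_nonneg hμ.le hr
  have hmono : Real.tan (π / L) ≤ Real.tan (π / L + μ * r) :=
    Real.strictMonoOn_tan.monotoneOn ⟨by linarith [Real.pi_pos], by linarith⟩ ⟨by linarith [Real.pi_pos], hang⟩ (by linarith)
  have h := div_le_div_of_nonneg_right hmono hμ.le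
  linarith

/-- ★ **The vacuum-radius window of the pscaling assembly** (`0 < Λ ≤ 1`, `L ≥ 3`): floor `√2·radiusR Λ ≤ 2/Λ` (= `√2R ≤ R_v`, p572436), the assembly's
cap in the form `√2·R_v·Λ < π` at `R_v = 2/Λ`, and the chain `2/Λ < π/(√2Λ) < 2π/Λ < (2L/Λ)·tan(π/L)` placing the cap a factor `2√2` below the echo threshold
of `Negative/EchoZoneFailure`. [cite: Luscher1983, §2–§3] -/
theorem vacuumRadius_window {Λ : ℝ} (hΛ : 0 < Λ) (hΛ1 : Λ ≤ 1) {L : ℕ} (hL : 3 ≤ L) :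
    Real.sqrt 2 * radiusR Λ ≤ 2 / Λ ∧ Real.sqrt 2 * (2 / Λ) * Λ < π ∧ 2 / Λ < π / (Real.sqrt 2 * Λ) ∧
      π / (Real.sqrt 2 * Λ) < 2 * π / Λ ∧ 2 * π / Λ < Real.tan (π / L) / (Λ / (2 * L)) := by
  have hs0 : 0 < Real.sqrt 2 := Real.sqrt_pos.2 two_pos
  refine ⟨sqrt_two_mul_radiusR_le hΛ hΛ1, sqrt_two_mul_radiusV_mul_lt_pi hΛ, ?_, ?_, twoPi_div_lt_echoThreshold hΛ hL⟩
  · rw [div_lt_div_iff₀ hΛ (by positivity)]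
    nlinarith [Real.pi_gt_three, sqrt_two_lt_three_halves]
  · rw [div_lt_div_iff₀ (by positivity) hΛ]
    nlinarith [mul_pos Real.pi_pos hΛ, mul_pos (mul_pos Real.pi_pos hΛ) (sub_pos.2 one_lt_sqrt_two)]

/-- ★ **The echo-zone refutation never reaches an admissible vacuum radius.**  For `L ≥ 3` and any radius obeying the assembly's cap `√2·R_v·Λ < π`
(in particular the lead's `R_v = 2/Λ`), the radius hypothesis of `Negative.shadowObs_mul_ground_not_ae_of_radius` — `tan(π/L + μ‖y‖)/μ + ‖y‖ ≤ R_v`,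
`μ = Λ/(2L)` — is NOT met at any lit point (`‖y‖ = r ≥ 0`, `π/L + μr < π/2`): the certified failure zone and the assembly's radii are disjoint, uniformly
in `L`. [cite: Luscher1983, §2–§3] -/
theorem echoZone_misses_admissible_radius {Λ Rv : ℝ} (hΛ : 0 < Λ) (hcap : Real.sqrt 2 * Rv * Λ < π) {L : ℕ} (hL : 3 ≤ L) {r : ℝ} (hr : 0 ≤ r)
    (hang : π / L + Λ / (2 * L) * r < π / 2) :
    ¬ Real.tan (π / L + Λ / (2 * L) * r) / (Λ / (2 * L)) + r ≤ Rv := by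
  intro h
  have hL' : (3 : ℝ) ≤ L := by exact_mod_cast hL
  have hLpos : (0 : ℝ) < L := by linarith
  have hμ : 0 < Λ / (2 * L) := by positivity
  have h1 := twoPi_div_lt_echoThreshold hΛ hL
  have h2 := echoThreshold_origin_le hL hμ hr hang
  -- `Rv < π/(√2Λ) < 2π/Λ`
  have hs0 : 0 < Real.sqrt 2 := Real.sqrt_pos.2 two_pos
  have hRv : Rv < 2 * π / Λ := by
    rw [lt_div_iff₀ hΛ]
    nlinarith [Real.pi_pos, one_lt_sqrt_two, mul_pos hs0 hΛ]
  linarith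

/-! ## §2 (S8) forces an exponential fine size -/

/-- ★ **(S8) ⟹ `256·Q·X·e^{(4/9)/Λ} ≤ c_gap·Λ³·L`** (`Q = (C_F/c_Q)²`, `X = C₁ + (E_{K+1}+C₁)² + K_c/4` in p575204; here any `Q, A ≥ 0`, `c_gap, L > 0`, `X` real):
the vacuum-tail term is dropped and `e^{2·(4/18)·R⁴} = e^{(4/9)/Λ}` by `R⁴ = 1/Λ`. [cite: Luscher1983, §2–§3] -/
theorem sideCondition_eight_forces_L {Λ L Q X A cgap : ℝ} (hΛ : 0 < Λ) (hL : 0 < L) (hQ : 0 ≤ Q) (hA : 0 ≤ A) (hcgap : 0 < cgap)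
    (hS8 : Q * Real.exp (2 * (4 * (1 / 18) * radiusR Λ ^ 4)) * ((X * (Λ / L) + A * Real.exp (-(2 / Λ))) / cgap) ≤ Λ ^ 4 / 256) :
    256 * Q * X * Real.exp ((4 / 9) / Λ) ≤ cgap * Λ ^ 3 * L := by
  have he : Real.exp (2 * (4 * (1 / 18) * radiusR Λ ^ 4)) = Real.exp ((4 / 9) / Λ) := by
    rw [radiusR_pow_four hΛ]; congr 1; ring
  rw [he] at hS8
  have hE0 : 0 < Real.exp ((4 / 9) / Λ) := Real.exp_pos _
  have htail : 0 ≤ A * Real.exp (-(2 / Λ)) := mul_nonneg hA (Real.exp_pos _).le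
  have hmono : X * (Λ / L) / cgap ≤ (X * (Λ / L) + A * Real.exp (-(2 / Λ))) / cgap :=
    div_le_div_of_nonneg_right (by linarith) hcgap.le
  have h1 : Q * Real.exp ((4 / 9) / Λ) * (X * (Λ / L) / cgap) ≤ Λ ^ 4 / 256 :=
    (mul_le_mul_of_nonneg_left hmono (mul_nonneg hQ hE0.le)).trans hS8
  have h2 : Q * Real.exp ((4 / 9) / Λ) * (X * (Λ / L) / cgap) = (256 * Q * X * Real.exp ((4 / 9) / Λ)) * Λ / (256 * (L * cgap)) := by
    field_simp
  rw [h2, div_le_div_iff₀ (by positivity) (by norm_num)] at h1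
  -- `h1 : 256·Q·X·E·Λ·256 ≤ Λ⁴·(256·(L·c_gap))`
  have h3 : (256 * Q * X * Real.exp ((4 / 9) / Λ)) * Λ ≤ (cgap * Λ ^ 3 * L) * Λ := by nlinarith [h1]
  exact le_of_mul_le_mul_right h3 hΛ

/-- ★ **Honest size of `L0`**: if moreover `c_gap ≤ Q·X`, (S8) forces `256·e^{(4/9)/Λ}/Λ³ ≤ L`; hence every `L0(lam)` of a shell through p575204 is at least
`256·e^{(4/9)/lam}/lam³` (the condition is needed at `Λ = lam`). [cite: Luscher1983, §2–§3] -/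
theorem sideCondition_eight_L_ge {Λ L Q X A cgap : ℝ} (hΛ : 0 < Λ) (hL : 0 < L) (hQ : 0 ≤ Q) (hA : 0 ≤ A) (hcgap : 0 < cgap)
    (hQX : cgap ≤ Q * X)
    (hS8 : Q * Real.exp (2 * (4 * (1 / 18) * radiusR Λ ^ 4)) * ((X * (Λ / L) + A * Real.exp (-(2 / Λ))) / cgap) ≤ Λ ^ 4 / 256) :
    256 * Real.exp ((4 / 9) / Λ) / Λ ^ 3 ≤ L := by
  have h := sideCondition_eight_forces_L hΛ hL hQ hA hcgap hS8
  have hE0 : 0 < Real.exp ((4 / 9) / Λ) := Real.exp_pos _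
  have h1 : (256 * Real.exp ((4 / 9) / Λ)) * cgap ≤ (cgap * Λ ^ 3 * L) := by
    nlinarith [mul_le_mul_of_nonneg_left hQX (by positivity : (0 : ℝ) ≤ 256 * Real.exp ((4 / 9) / Λ))]
  rw [div_le_iff₀ (pow_pos hΛ 3)]
  nlinarith [h1]

/-! ## §3 (S6) forces a tiny scale -/

/-- ★ **(S6) ⟹ `P·A·e^{−R} ≤ c_gap·Λ²/4`** (`P = (2A′+1)^{K+2}`, `A′ = 2(K+1)(1 + C_top/c_gap) + 1`, `ε♭ = 24/L² + 4C_F²I₉e^{−R}` in p575204; here any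
`P, X, A′ ≥ 0`, `L, c_gap > 0`). [cite: Luscher1983, §2–§3] -/
theorem sideCondition_six_forces {Λ L P X A cgap A' εb : ℝ} (hΛ : 0 < Λ) (hL : 0 < L) (hP : 0 ≤ P) (hX : 0 ≤ X) (hA' : 0 ≤ A')
    (hcgap : 0 < cgap)
    (hS6 : P * ((X * (Λ / L) + A * Real.exp (-radiusR Λ)) / cgap + 2 * A' * εb ^ 2) ≤ Λ ^ 2 / 4) :
    P * A * Real.exp (-radiusR Λ) ≤ cgap * (Λ ^ 2 / 4) := by
  have hXL : 0 ≤ X * (Λ / L) := mul_nonneg hX (div_nonneg hΛ.le hL.le)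
  have h0 : A * Real.exp (-radiusR Λ) / cgap ≤ (X * (Λ / L) + A * Real.exp (-radiusR Λ)) / cgap :=
    div_le_div_of_nonneg_right (by linarith) hcgap.le
  have hε : 0 ≤ 2 * A' * εb ^ 2 := by positivity
  have h1 : A * Real.exp (-radiusR Λ) / cgap ≤ (X * (Λ / L) + A * Real.exp (-radiusR Λ)) / cgap + 2 * A' * εb ^ 2 := by linarith
  have h2 : P * (A * Real.exp (-radiusR Λ) / cgap) ≤ Λ ^ 2 / 4 := (mul_le_mul_of_nonneg_left h1 hP).trans hS6
  rw [show P * (A * Real.exp (-radiusR Λ) / cgap) = P * A * Real.exp (-radiusR Λ) / cgap by ring, div_le_iff₀ hcgap] at h2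
  linarith

/-- ★ **At `Λ = 2·10⁻⁶` the observable tail beats the allowance**: `Λ²/4 = 10⁻¹² < e^{−27} < e^{−radiusR Λ}` (`radiusR Λ = 500000^{1/4} < 27`,
`e^{27} < 2.72^{27} < 10¹²`). [folklore] -/
theorem exp_neg_radiusR_gt_at_2e6 : (1 / 500000 : ℝ) ^ 2 / 4 < Real.exp (-radiusR (1 / 500000)) := by
  have hR : radiusR (1 / 500000) < 27 := by
    show Real.sqrt (Real.sqrt (1 / (1 / 500000))) < 27
    rw [show (1 : ℝ) / (1 / 500000) = 500000 by norm_num, Real.sqrt_lt' (by norm_num : (0 : ℝ) < 27),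
      Real.sqrt_lt' (by norm_num : (0 : ℝ) < 27 ^ 2)]
    norm_num
  have h1 : Real.exp (-27) < Real.exp (-radiusR (1 / 500000)) := Real.exp_lt_exp.2 (by linarith)
  refine lt_trans ?_ h1
  rw [Real.exp_neg, show ((1 : ℝ) / 500000) ^ 2 / 4 = ((10 : ℝ) ^ 12)⁻¹ by norm_num,
    inv_lt_inv₀ (by positivity) (Real.exp_pos 27)]
  have he : Real.exp 1 < 2.72 := lt_trans Real.exp_one_lt_d9 (by norm_num)
  have h27 : Real.exp 27 = Real.exp 1 ^ 27 := by rw [← Real.exp_nat_mul]; norm_num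
  rw [h27]
  calc Real.exp 1 ^ 27 < (2.72 : ℝ) ^ 27 := pow_lt_pow_left₀ he (Real.exp_pos 1).le (by norm_num)
    _ < (10 : ℝ) ^ 12 := by norm_num

/-- ★★ **Honest size of `lam0`**: if `c_gap ≤ P·A`, the side condition (S6) of p575204 FAILS at `Λ = 2·10⁻⁶` for EVERY fine size `L` (and all values of
the remaining constants).  Since a shell must serve `lam = 10⁻⁶ ≤ lam0` at `Λ = 2·lam`, every witness of `PScalingExistsForL (TransplantBasisLR k)` built
through p575204 has `lam0 < 10⁻⁶`. [cite: Luscher1983, §2–§3] -/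
theorem sideCondition_six_fails_at_2e6 {L P X A cgap A' εb : ℝ} (hL : 0 < L) (hP : 0 ≤ P) (hX : 0 ≤ X) (hA' : 0 ≤ A') (hcgap : 0 < cgap)
    (hPA : cgap ≤ P * A) :
    ¬ P * ((X * ((1 / 500000 : ℝ) / L) + A * Real.exp (-radiusR (1 / 500000))) / cgap + 2 * A' * εb ^ 2) ≤ (1 / 500000 : ℝ) ^ 2 / 4 := by
  intro hS6
  have h := sideCondition_six_forces (by norm_num) hL hP hX hA' hcgap hS6
  have hpt := exp_neg_radiusR_gt_at_2e6
  have he0 := Real.exp_pos (-radiusR (1 / 500000))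
  nlinarith [mul_le_mul_of_nonneg_right hPA he0.le, mul_pos hcgap (sub_pos.2 hpt)]

end Summit.QuantumFields.YangMills.Theorems.FemtoTransferGap.PolyakovLift.Negative

end
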